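import Summits.AtomisticToContinuum.Crystallization.Theorems.FrustratedLawDichotomyCellF1Labels

/-!
# FrustratedLawDichotomy · crux `AperiodicFrustratedLawGap` (stmt-AtomisticToContinuum-27623) — class-A K-file tower, layer 2c:
the COMPLETE F1 LABEL SET `MF1c` (KFILE amendment E2 «complete-template rule of record», critic r1861 (A)(E2)/(E4); decomp-a2c hand-2 g48)

TEMPLATE-COMPLETENESS (lens-5 FINDING l.9752, ruled r1861): the F1 label set of record for class-A rows is the COMPLETE template
`MF1c := {z parity label : (1 − 3ε)·|Tz|² ≤ (Rc + τ)²}` (every site whose `τ`-tube meets the `Rc`-window for SOME strain of the box; `ε = τ = 2⁻¹⁰`,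
`Rc = 13`; cut radius `13.02006`): 14 153 labels = the 14 065 of #84's `MF1` + 88 collar labels, 903 non-root distance classes (904 with the root).
This file is #84 `…CellF1Labels` RE-BASED on that cut, reusing #84's enumeration (`boxF1`, `qkF`, `intF1`/`MIF1` — the interior set is UNCHANGED):

* §1 the threshold `BLc = ⌊2²⁸(13 + 2⁻¹⁰)²/(1 − 3·2⁻¹⁰)⌋ = 45 505 725 619`, `admLc`/`admLFc` (kernel-cheap), `admLc_iff`, `admLc_of_admL` (`MF1 ⊆ MF1c`),
  `cube_of_qk_le_BLc` (the box `[-20,20] × [-18,18]²` still holds the cut), `admLc_act` (closure under `Stab16`), `labF1c`, `labF1c'` (non-root),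
  `mem_labF1c` BY PREDICATE, `Nodup`;
* §2 the `Finset` façade `MF1c` (irreducible) with the membership / sum / forall / filter bridges, `MIF1 ⊆ MF1 ⊆ MF1c`, `0 ∈ MF1c`, `erase_MF1c_eq`;
* §3 closure `hMc`, parity `hparc`, ★ separation `hsepc` (via #83 `sep_F1`, list-free), and ★ COMPLETENESS `mem_Mc_of_window`:
  a parity label with `(1 − 3ε)·qk/2²⁸ ≤ (13 + 2⁻¹⁰)²` IS in `MF1c` (the clause-2 half of the inhabitation witness of amendment E2 — every lattice atom of
  `B̄(13)` under a box strain is a template atom); NO `hwin` (dropped by design: the primed door (362) does not ask for it);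
* §4 kernel facts `labF1c_length = 14153`, `labF1c'_length = 14152`, `card_Mc`.
Imports TREE #84 `…CellF1Labels`; 0 sorry.  Tags: [new: K-file data layer]; nothing here closes an item.
-/

namespace Summit.AtomisticToContinuum.Crystallization.Theorems.FrustratedLawDichotomyCellF1cLabels

open scoped BigOperators
open Summit.AtomisticToContinuum.Crystallization.Theorems.FrustratedLawDichotomyCellMetric (posL)
open Summit.AtomisticToContinuum.Crystallization.Theorems.FrustratedLawDichotomyCellTriples (zT sumT)
open Summit.AtomisticToContinuum.Crystallization.Theorems.FrustratedLawDichotomyCellSymmZ3 (actZ)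
open Summit.AtomisticToContinuum.Crystallization.Theorems.FrustratedLawDichotomyCellStab16 (RZ Rr image_eq even_sumT_act_iff)
open Summit.AtomisticToContinuum.Crystallization.Theorems.FrustratedLawDichotomyCellF1Frame
open Summit.AtomisticToContinuum.Crystallization.Theorems.FrustratedLawDichotomyCellF1Labels

/-! ## §1 The complete-template cut and the enumeration -/

/-- label threshold of the COMPLETE template: `qk ≤ BLc ⇔ (1 − 3ε)·|Tz|² ≤ (Rc + τ)²` (`BLc = ⌊2²⁸·(13 + 2⁻¹⁰)²/(1 − 3·2⁻¹⁰)⌋`). -/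
def BLc : ℤ := 45505725619

/-- label admissibility, complete template: parity ∧ `qk ≤ BLc`. -/
def admLc (m : ℤ × ℤ × ℤ) : Bool := (sumT m % 2 == 0) && decide (qk m ≤ BLc)

/-- label admissibility, kernel-cheap form (closed-form key). -/
def admLFc (m : ℤ × ℤ × ℤ) : Bool := (sumT m % 2 == 0) && decide (qkF m ≤ BLc)

/-- the kernel-cheap predicate IS `admLc`. -/
theorem admLFc_eq (m : ℤ × ℤ × ℤ) : admLFc m = admLc m := by
  unfold admLFc admLc; rw [qkF_eq]

/-- admissibility, unfolded. -/
theorem admLc_iff (m : ℤ × ℤ × ℤ) : admLc m = true ↔ Even (sumT m) ∧ qk m ≤ BLc := by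
  simp [admLc, Bool.and_eq_true, beq_iff_eq, decide_eq_true_eq, Int.even_iff]

/-- the old (window-cut) labels are complete-template labels: `MF1 ⊆ MF1c`. -/
theorem admLc_of_admL {m : ℤ × ℤ × ℤ} (h : admL m = true) : admLc m = true := by
  rw [admL_iff] at h; rw [admLc_iff]; exact ⟨h.1, h.2.trans (by unfold BL BLc; norm_num)⟩

/-- interior labels are complete-template labels. -/
theorem admLc_of_admI {m : ℤ × ℤ × ℤ} (h : admI m = true) : admLc m = true := admLc_of_admL (admL_of_admI h)

/-- `BLc` is SOUND for the complete-template cut: `(1 − 3ε)·BLc/16384² ≤ (Rc + τ)²`. -/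
theorem BLc_sound : (1 - 3 * (1 / 1024 : ℝ)) * ((BLc : ℝ) / 16384 ^ 2) ≤ (13 + 1 / 1024) ^ 2 := by unfold BLc; norm_num

/-- `BLc` is COMPLETE for the cut: an integer key with `(1 − 3ε)·q/16384² ≤ (Rc + τ)²` is `≤ BLc`. -/
theorem le_BLc_of_window {q : ℤ} (h : (1 - 3 * (1 / 1024 : ℝ)) * ((q : ℝ) / 16384 ^ 2) ≤ (13 + 1 / 1024) ^ 2) : q ≤ BLc := by
  unfold BLc
  have h' : (q : ℝ) < 45505725619 + 1 := by nlinarith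
  have h'' : q < 45505725619 + 1 := by exact_mod_cast h'
  omega

/-- the cube bound for complete-template labels: `|z₀| ≤ 20`, `|z₁|, |z₂| ≤ 18` (the box of #84 still holds the cut). -/
theorem cube_of_qk_le_BLc {m : ℤ × ℤ × ℤ} (h : qk m ≤ BLc) : |m.1| ≤ 20 ∧ |m.2.1| ≤ 18 ∧ |m.2.2| ≤ 18 := by
  rw [qk_eq] at h; unfold BLc at h
  have h0 := mul_self_nonneg m.1; have h1 := mul_self_nonneg m.2.1; have h2 := mul_self_nonneg m.2.2
  refine ⟨abs_le.mpr ⟨?_, ?_⟩, abs_le.mpr ⟨?_, ?_⟩, abs_le.mpr ⟨?_, ?_⟩⟩ <;> nlinarith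

/-- `admLc` is invariant under `Stab16` (closure by predicate). -/
theorem admLc_act (k : Fin 16) (m : ℤ × ℤ × ℤ) : admLc (actZ (RZ k) m) = admLc m := by
  rw [Bool.eq_iff_iff, admLc_iff, admLc_iff, qk_act, even_sumT_act_iff]

/-- ★ the COMPLETE F1 labels (census N9F1_56b: 14 153). -/
def labF1c : List (ℤ × ℤ × ℤ) := (boxF1 20 18).filter admLFc

/-- the non-root complete labels. -/
def labF1c' : List (ℤ × ℤ × ℤ) := labF1c.filter fun x => decide (x ≠ 0)

/-- ★ membership of a label BY PREDICATE. -/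
theorem mem_labF1c {m : ℤ × ℤ × ℤ} : m ∈ labF1c ↔ admLc m = true := by
  simp only [labF1c, List.mem_filter, mem_boxF1, admLFc_eq]
  constructor
  · exact fun h => h.2
  · intro h
    have hc := cube_of_qk_le_BLc ((admLc_iff m).mp h).2
    exact ⟨⟨by exact_mod_cast hc.1, by exact_mod_cast hc.2.1, by exact_mod_cast hc.2.2⟩, h⟩

/-- the label list has no duplicates. -/
theorem labF1c_nodup : labF1c.Nodup := (boxF1_nodup 20 18).filter _

/-- the non-root label list has no duplicates. -/
theorem labF1c'_nodup : labF1c'.Nodup := labF1c_nodup.filter _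

/-! ## §2 The `Finset` façade (never evaluated) -/

/-- ★ the COMPLETE label set `MF1c` of the F1 cell (IRREDUCIBLE for the elaborator; every use goes through the bridges below). -/
@[irreducible] def MF1c : Finset (ℤ × ℤ × ℤ) := labF1c.toFinset

/-- membership in `MF1c` by predicate. -/
theorem mem_Mc {m : ℤ × ℤ × ℤ} : m ∈ MF1c ↔ admLc m = true := by rw [MF1c, List.mem_toFinset, mem_labF1c]

/-- `Σ_{m ∈ MF1c}` is a list sum. -/
theorem sum_Mc {β : Type*} [AddCommMonoid β] (f : ℤ × ℤ × ℤ → β) : ∑ m ∈ MF1c, f m = (labF1c.map f).sum := by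
  rw [MF1c, List.sum_toFinset _ labF1c_nodup]

/-- `∀ m ∈ MF1c` is a list fact. -/
theorem forall_Mc {P : ℤ × ℤ × ℤ → Prop} : (∀ m ∈ MF1c, P m) ↔ ∀ m ∈ labF1c, P m := by
  simp only [MF1c, List.mem_toFinset]

/-- a filter of `MF1c` is the filtered list. -/
theorem filter_Mc (p : ℤ × ℤ × ℤ → Prop) [DecidablePred p] : MF1c.filter p = (labF1c.filter fun m => decide (p m)).toFinset := by
  rw [MF1c, List.toFinset_filter]
  exact Finset.filter_congr fun x _ => by simp

/-- `MF1c ∖ {0}` is the non-root list. -/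
theorem erase_MF1c_eq : MF1c.erase 0 = labF1c'.toFinset := by
  ext x
  simp only [Finset.mem_erase, labF1c', List.mem_toFinset, List.mem_filter, decide_eq_true_eq, mem_Mc, mem_labF1c]
  tauto

/-- `Σ_{m ∈ MF1c ∖ 0}` is a list sum over the non-root list. -/
theorem sum_erase_Mc {β : Type*} [AddCommMonoid β] (f : ℤ × ℤ × ℤ → β) : ∑ m ∈ MF1c.erase 0, f m = (labF1c'.map f).sum := by
  rw [erase_MF1c_eq, List.sum_toFinset _ labF1c'_nodup]

/-- the old label set sits inside the complete one: `MF1 ⊆ MF1c`. -/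
theorem M_subset_Mc : MF1 ⊆ MF1c := fun _ hm => mem_Mc.mpr (admLc_of_admL (mem_M.mp hm))

/-- interior labels are complete labels: `MIF1 ⊆ MF1c`. -/
theorem MI_subset_Mc : MIF1 ⊆ MF1c := fun _ hm => mem_Mc.mpr (admLc_of_admI (mem_MI.mp hm))

/-- the root is a complete label. -/
theorem zero_mem_Mc : (0 : ℤ × ℤ × ℤ) ∈ MF1c := MI_subset_Mc zero_mem_MI

/-! ## §3 Closure under `Stab16`, the list-free door hypotheses, completeness -/

/-- `MF1c` is closed under every element of `Stab16`. -/
theorem Mc_act_mem (k : Fin 16) : ∀ x ∈ MF1c, actZ (RZ k) x ∈ MF1c := fun x hx => mem_Mc.mpr (by rw [admLc_act]; exact mem_Mc.mp hx)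

/-- (hM) `MF1c·act = MF1c`. -/
theorem hMc (k : Fin 16) : MF1c.image (actZ (RZ k)) = MF1c := image_eq k (Mc_act_mem k)

/-- every complete label is a parity label. -/
theorem hparc : ∀ m ∈ MF1c, Even (sumT m) := fun m hm => ((admLc_iff m).mp (mem_Mc.mp hm)).1

/-- ★ (hsep) the strained template is `7/10`-separated on `MF1c` for every `F` of the strain cell — no list work. -/
theorem hsepc {F : Matrix (Fin 3) (Fin 3) ℝ} (hG : ∀ i j, |(F.transpose * F) i j - (if i = j then 1 else 0)| ≤ 1 / 1024) :
    ∀ z ∈ MF1c, ∀ z' ∈ MF1c, z ≠ z' →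
      (7 / 10 : ℝ) ≤ dist (posL F (T.mulVec fun j => (zT z j : ℝ))) (posL F (T.mulVec fun j => (zT z' j : ℝ))) :=
  fun z hz z' hz' hne => sep_F1 hG (hparc z hz) (hparc z' hz') hne

/-- the cut read back in the template scalar: every complete label has `(1 − 3ε)·Σᵢ(T·z)ᵢ² ≤ (Rc + τ)²`. -/
theorem window_of_admLc {m : ℤ × ℤ × ℤ} (h : qk m ≤ BLc) :
    (1 - 3 * (1 / 1024 : ℝ)) * ∑ i, (T.mulVec (fun j => (zT m j : ℝ)) i) ^ 2 ≤ (13 + 1 / 1024) ^ 2 := by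
  rw [sumSq_T]
  have h' : (qk m : ℝ) ≤ BLc := by exact_mod_cast h
  refine le_trans ?_ BLc_sound
  exact mul_le_mul_of_nonneg_left (div_le_div_of_nonneg_right h' (by positivity)) (by norm_num)

/-- ★ COMPLETENESS OF THE TEMPLATE: a parity label whose tube can meet the window under a box strain — `(1 − 3ε)·Σᵢ(T·z)ᵢ² ≤ (Rc + τ)²` — IS a
complete label (the clause-2 half of amendment E2's inhabitation witness). -/
theorem mem_Mc_of_window {m : ℤ × ℤ × ℤ} (hpar : Even (sumT m))
    (h : (1 - 3 * (1 / 1024 : ℝ)) * ∑ i, (T.mulVec (fun j => (zT m j : ℝ)) i) ^ 2 ≤ (13 + 1 / 1024) ^ 2) : m ∈ MF1c := by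
  rw [sumSq_T] at h
  exact mem_Mc.mpr ((admLc_iff m).mpr ⟨hpar, le_BLc_of_window h⟩)

/-! ## §4 Kernel facts (census N9F1_56b counts) -/

/-- ★ the complete F1 cell has exactly `14 153` labels. -/
theorem labF1c_length : labF1c.length = 14153 := by decide +kernel

/-- … and `14 152` non-root labels. -/
theorem labF1c'_length : labF1c'.length = 14152 := by decide +kernel

/-- `|MF1c| = 14 153`. -/
theorem card_Mc : MF1c.card = 14153 := by rw [MF1c, List.toFinset_card_of_nodup labF1c_nodup, labF1c_length]

end Summit.AtomisticToContinuum.Crystallization.Theorems.FrustratedLawDichotomyCellF1cLabels
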